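import Mathlib.Analysis.SpecialFunctions.ExpDeriv
import Mathlib.LinearAlgebra.Dual.Lemmas
import Mathlib.LinearAlgebra.Eigenspace.Triangularizable
import Mathlib.FieldTheory.IsAlgClosed.Basic
import Mathlib.Analysis.Complex.Polynomial.Basic
import Literature.NumberTheory.Automorphic.GKModules
import HarnessLib

/-!
# One-parameter subgroups of `K` on eigenvectors in a `(𝔤, K)`-module

Companion to `Literature.NumberTheory.Automorphic.GKModules` (the `(𝔤, K)`-module axioms
`IsGKModule G ρK ρ𝔤` of Wallach, *Real Reductive Groups I*, §3.3.1: `K`-finiteness, weak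
continuity, `Ad`-compatibility and the weak differential `hasWeakDeriv` of `ρK` along `𝔨`).
This file draws the elementary consequences of `hasWeakDeriv` that turn **`𝔨`-weights into
`K`-types** — the passage, for `SO(2) ⊆ GL₂(ℝ)`, from "`H φ = m φ`" to "`φ(g r(θ)) = e^{imθ} φ(g)`"
(Bump, *Automorphic Forms and Representations* (1997), §2.5, the `K`-types `Σ` of the
`(𝔤, K)`-modules of `GL₂(ℝ)`; Wallach §3.3.1; Knapp–Vogan (1.64)–(1.65)) — for an *abstract*
`(𝔤, K)`-module, with no finite-dimensionality or continuity beyond the axioms: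

* `RealMatrixGroup.expK_add_smul`, `expK_zero_smul` — `t ↦ expK (t X)` is a one-parameter
  subgroup of `K`.
* `IsGKModule.hasDerivAt_coeff` — the matrix coefficient `t ↦ ℓ (ρK (exp tX) v)` has derivative
  `ℓ (ρK (exp tX) (ρ𝔤 X v))` at **every** `t` (translate the functional).
* `IsGKModule.apply_expK_smul_of_eigenvector` — **`ρ𝔤 X v = c v` ⟹ `ρK (exp tX) v = e^{ct} v`**
  (`g' = c g` for every coefficient, so `e^{-ct} g` is constant; functionals separate points);
  `eigenvector_of_apply_expK_smul` — the converse; `exp_mul_eq_one_of_eigenvector` — if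
  `exp (T X) = 1` in `K` then `e^{cT} = 1` (quantisation of `𝔨`-weights, e.g. `T = 2π` for the
  generator of `SO(2)`); `apply_expK_mem_of_span_eigenvectors` — subspaces spanned by
  `ρ𝔤 X`-eigenvectors are `exp tX`-stable.
* `IsGKModule.apply_mem_of_expK_stable` — an `exp tX`-stable subspace is `ρ𝔤 X`-stable
  (`U = U^{⊥⊥}`); `exists_eigenvector_of_expK_stable`, `exists_eigenvector` — hence
  `ρ𝔤 X`-eigenvectors exist (in the `K`-span of any non-zero vector, which is finite-dimensional
  by `kFinite`; `ℂ` is algebraically closed).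

Everything is proved; no definition, no named fact.  With the tree's proved
`AutomorphicRepData.isGKModule_of_hasLieAction_holds` (`AutomorphicFormsGKModuleProofs`) these
apply to the space `W / W'` of every automorphic representation datum; downstream use: the
weight-one vector of a representation of `GL₂(𝔸_ℚ)` of weight one
(`AutomorphicRepData.IsOfWeightOne`, `StrongArtinGL2WeightOneDictionary`; Gelbart 1997,
Remark 2.5.5), for `Literature.NumberTheory.Automorphic.exists_isNewform1_of_isPiOfArtinRep`.

## Mathlib / Literature search

`IsGKModule`, `RealMatrixGroup.expK`, `expGL_add_smul` are the tree's (`GKModules`,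
`RealMatrixGroups`); from Mathlib: `HasDerivAt.comp_sub_const`, `is_const_of_deriv_eq_zero`,
`Complex.hasDerivAt_exp`, `Module.forall_dual_apply_eq_zero_iff`,
`Subspace.forall_mem_dualAnnihilator_apply_eq_zero_iff`, `Module.End.exists_eigenvalue`.  Mathlib
has no `(𝔤, K)`-modules (`lean search 'IsGKModule|gK_module'`: tree only). Nothing here duplicates
an existing declaration (`lean search 'expK_add|apply_expK|hasDerivAt_coeff'`: no hits).

## References

* N. R. Wallach, *Real Reductive Groups I*, Academic Press 1988, §3.3.1. [WallachRRG1]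
* A. W. Knapp, D. A. Vogan, *Cohomological Induction and Unitary Representations* (1995), §I.4,
  (1.64)–(1.65). [KnappVogan1995]
* D. Bump, *Automorphic Forms and Representations* (1997), §2.5 (K-types of `(𝔤𝔩₂, O(2))`-modules).
  [Bump1997]
-/

-- Mathlib idiom (Mathlib/Algebra/Lie/OfAssociative.lean); needed to mention Lie subalgebras of matrix algebras
attribute [local instance 100] LieRing.ofAssociativeRing

open scoped MatrixGroups Matrix

noncomputable section

namespace Literature.NumberTheory.Automorphic

variable {A : Type*} [NormedCommRing A] [NormedAlgebra ℝ A] [NormedAlgebra ℚ A] [CompleteSpace A]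
  [StarRing A] [StarModule ℝ A] [ContinuousStar A] {N : Type*} [Fintype N] [DecidableEq N]
  {G : RealMatrixGroup A N}
  {V : Type*} [AddCommGroup V] [Module ℂ V]
  {ρK : Representation ℂ G.maximalCompact V} {ρ𝔤 : G.lie →ₗ⁅ℝ⁆ Module.End ℂ V}

namespace RealMatrixGroup

/-- `expK ((s + t) X) = expK (s X) * expK (t X)`: `t ↦ expK (t X)` is a one-parameter subgroup of
`K`. Knapp, 0.§2, Prop. 0.11 (c). [folklore] -/
theorem expK_add_smul (s t : ℝ) (X : G.compactLie) :
    G.expK ((s + t) • X) = G.expK (s • X) * G.expK (t • X) := by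
  refine Subtype.ext ?_
  change expGL ((s + t) • (X : Matrix N N A)) =
    expGL (s • (X : Matrix N N A)) * expGL (t • (X : Matrix N N A))
  exact expGL_add_smul s t _

/-- `expK (0 • X) = 1`. [folklore] -/
theorem expK_zero_smul (X : G.compactLie) : G.expK ((0 : ℝ) • X) = 1 := by
  refine Subtype.ext ?_
  change expGL ((0 : ℝ) • (X : Matrix N N A)) = 1
  rw [zero_smul, expGL_zero]

end RealMatrixGroup

namespace IsGKModule

/-- **The weak derivative of the orbit map along `𝔨` at an arbitrary time.** In a
`(𝔤, K)`-module, for `X ∈ 𝔨`, `v ∈ V` and a functional `ℓ`, the matrix coefficient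
`t ↦ ℓ (ρK (exp tX) v)` has derivative `ℓ (ρK (exp tX) (ρ𝔤 X v))` at every `t` (the axiom
`hasWeakDeriv` is the case `t = 0`; translate the functional by `ρK (exp tX)` and use
`exp (t + s)X = exp tX exp sX`). Wallach, *Real Reductive Groups I*, §3.3.1; Knapp–Vogan (1.65).
[folklore] -/
theorem hasDerivAt_coeff (h : IsGKModule G ρK ρ𝔤) (X : G.compactLie) (v : V) (ℓ : Module.Dual ℂ V)
    (t : ℝ) :
    HasDerivAt (fun s : ℝ ↦ ℓ (ρK (G.expK (s • X)) v))
      (ℓ (ρK (G.expK (t • X)) (ρ𝔤 (LieSubalgebra.inclusion G.compactLie_le_lie X) v))) t := by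
  -- the translated functional
  have h0 := h.hasWeakDeriv X v (ℓ ∘ₗ ρK (G.expK (t • X)))
  simp only [LinearMap.coe_comp, Function.comp_apply] at h0
  have h1 : HasDerivAt (fun s : ℝ ↦ ℓ (ρK (G.expK ((t + s) • X)) v))
      (ℓ (ρK (G.expK (t • X)) (ρ𝔤 (LieSubalgebra.inclusion G.compactLie_le_lie X) v))) 0 := by
    refine h0.congr_of_eventuallyEq (Filter.Eventually.of_forall fun s ↦ ?_)
    simp only [RealMatrixGroup.expK_add_smul, map_mul, Module.End.mul_apply]
  -- shift back
  have h2 := HasDerivAt.comp_sub_const (f := fun s : ℝ ↦ ℓ (ρK (G.expK ((t + s) • X)) v)) t t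
    (by rwa [sub_self])
  refine h2.congr_of_eventuallyEq (Filter.Eventually.of_forall fun u ↦ ?_)
  simp only [add_sub_cancel]

/-- **Eigenvectors of `ρ𝔤 X`, `X ∈ 𝔨`, integrate to eigenvectors of the one-parameter group
`exp tX ⊆ K`.** In a `(𝔤, K)`-module, if `ρ𝔤 X v = c v` then `ρK (exp tX) v = e^{ct} v` for all
real `t`: every matrix coefficient `g(t) = ℓ (ρK (exp tX) v)` satisfies `g' = c g`
(`hasDerivAt_coeff`), so `e^{-ct} g(t)` is constant, and functionals separate points.  (No
finite-dimensionality is needed.)  This is the passage from `𝔨`-weights to `K`-types used for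
`SO(2) ⊆ GL₂(ℝ)`: a vector of `H`-weight `m` transforms under the rotation `r(θ) = exp θW` by
`e^{imθ}` (Bump 1997, §2.5, the `K`-types `Σ`; Wallach §3.3.1). [folklore] -/
theorem apply_expK_smul_of_eigenvector (h : IsGKModule G ρK ρ𝔤) (X : G.compactLie) {v : V} {c : ℂ}
    (hv : ρ𝔤 (LieSubalgebra.inclusion G.compactLie_le_lie X) v = c • v) (t : ℝ) :
    ρK (G.expK (t • X)) v = Complex.exp (c * t) • v := by
  -- test against every functional
  suffices hℓ : ∀ ℓ : Module.Dual ℂ V, ℓ (ρK (G.expK (t • X)) v - Complex.exp (c * t) • v) = 0 by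
    have := (Module.forall_dual_apply_eq_zero_iff ℂ _).1 hℓ
    exact sub_eq_zero.1 this
  intro ℓ
  set g : ℝ → ℂ := fun s ↦ ℓ (ρK (G.expK (s • X)) v) with hg
  have hderiv : ∀ s : ℝ, HasDerivAt g (c * g s) s := by
    intro s
    have := h.hasDerivAt_coeff X v ℓ s
    rw [hv, map_smul, map_smul, smul_eq_mul] at this
    exact this
  -- `s ↦ e^{-cs} g(s)` has zero derivative, hence is constant
  set F : ℝ → ℂ := fun s ↦ Complex.exp (-(c * s)) * g s with hF
  have hFderiv : ∀ s : ℝ, HasDerivAt F 0 s := by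
    intro s
    have he : HasDerivAt (fun s : ℝ ↦ Complex.exp (-(c * s))) (Complex.exp (-(c * s)) * (-c)) s := by
      have h1 : HasDerivAt (fun s : ℝ ↦ -(c * (s : ℂ))) (-c) s := by
        simpa using ((hasDerivAt_id (s : ℂ)).const_mul c).neg.comp_ofReal
      exact (Complex.hasDerivAt_exp _).comp s h1 |>.congr_deriv (by ring)
    have := he.mul (hderiv s)
    refine this.congr_deriv ?_
    ring
  have hconst : F t = F 0 := by
    have hdiff : Differentiable ℝ F := fun s ↦ (hFderiv s).differentiableAt
    exact is_const_of_deriv_eq_zero hdiff (fun s ↦ (hFderiv s).deriv) t 0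
  have hg0 : g 0 = ℓ v := by
    simp only [hg, RealMatrixGroup.expK_zero_smul, map_one, Module.End.one_apply]
  have hF0 : F 0 = ℓ v := by
    simp only [hF, hg0, Complex.ofReal_zero, mul_zero, neg_zero, Complex.exp_zero, one_mul]
  have hgt : g t = Complex.exp (c * t) * ℓ v := by
    have h1 : Complex.exp (-(c * t)) * g t = ℓ v := by rw [← hF0, ← hconst]
    have hne : Complex.exp (-(c * t)) ≠ 0 := Complex.exp_ne_zero _
    calc g t = Complex.exp (c * t) * (Complex.exp (-(c * t)) * g t) := by
          rw [← mul_assoc, ← Complex.exp_add, add_neg_cancel, Complex.exp_zero, one_mul]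
      _ = Complex.exp (c * t) * ℓ v := by rw [h1]
  rw [map_sub, map_smul, smul_eq_mul, ← hgt, sub_self]

/-- Conversely, **a vector transforming under `exp tX ⊆ K` by `e^{ct}` is an eigenvector of `ρ𝔤 X`
with eigenvalue `c`** (differentiate at `t = 0`, `hasWeakDeriv`). Wallach §3.3.1. [folklore] -/
theorem eigenvector_of_apply_expK_smul (h : IsGKModule G ρK ρ𝔤) (X : G.compactLie) {v : V} {c : ℂ}
    (hv : ∀ t : ℝ, ρK (G.expK (t • X)) v = Complex.exp (c * t) • v) :
    ρ𝔤 (LieSubalgebra.inclusion G.compactLie_le_lie X) v = c • v := by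
  suffices hℓ : ∀ ℓ : Module.Dual ℂ V,
      ℓ (ρ𝔤 (LieSubalgebra.inclusion G.compactLie_le_lie X) v - c • v) = 0 by
    exact sub_eq_zero.1 ((Module.forall_dual_apply_eq_zero_iff ℂ _).1 hℓ)
  intro ℓ
  have h1 := h.hasWeakDeriv X v ℓ
  have h2 : HasDerivAt (fun t : ℝ ↦ ℓ (ρK (G.expK (t • X)) v)) (c * ℓ v) 0 := by
    have he : HasDerivAt (fun t : ℝ ↦ Complex.exp (c * t) * ℓ v) (c * ℓ v) 0 := by
      have h3 : HasDerivAt (fun t : ℝ ↦ c * (t : ℂ)) c 0 := by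
        simpa using ((hasDerivAt_id ((0 : ℝ) : ℂ)).const_mul c).comp_ofReal
      have h4 := (Complex.hasDerivAt_exp _).comp (0 : ℝ) h3
      simp only [Complex.ofReal_zero, mul_zero, Complex.exp_zero, one_mul] at h4
      simpa using h4.mul_const (ℓ v)
    refine he.congr_of_eventuallyEq (Filter.Eventually.of_forall fun t ↦ ?_)
    simp only [hv t, map_smul, smul_eq_mul]
  have := h1.unique h2
  rw [map_sub, map_smul, smul_eq_mul, this, sub_self]

/-- **Periodicity quantises the eigenvalues.** If moreover `exp (T X) = 1` in `K` for some real
`T` (e.g. `T = 2π` for the generator of `SO(2)`), then `e^{cT} = 1`, i.e. `c T ∈ 2πi ℤ`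
(for `v ≠ 0`). [folklore] -/
theorem exp_mul_eq_one_of_eigenvector (h : IsGKModule G ρK ρ𝔤) (X : G.compactLie) {v : V} {c : ℂ}
    (hv : ρ𝔤 (LieSubalgebra.inclusion G.compactLie_le_lie X) v = c • v) (hv0 : v ≠ 0) {T : ℝ}
    (hT : G.expK (T • X) = 1) : Complex.exp (c * T) = 1 := by
  have h1 := h.apply_expK_smul_of_eigenvector X hv T
  rw [hT, map_one, Module.End.one_apply] at h1
  by_contra hne
  have : (1 - Complex.exp (c * T)) • v = 0 := by rw [sub_smul, one_smul, ← h1, sub_self]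
  rcases smul_eq_zero.1 this with h2 | h2
  · exact hne (sub_eq_zero.1 h2).symm
  · exact hv0 h2

/-- **Subspaces spanned by `𝔨`-weight vectors are stable under the one-parameter group.** If
`U ≤ V` is spanned by eigenvectors of `ρ𝔤 X` (`X ∈ 𝔨`), then `ρK (exp tX) U ⊆ U`.
Wallach §3.3.1. [folklore] -/
theorem apply_expK_mem_of_span_eigenvectors (h : IsGKModule G ρK ρ𝔤) (X : G.compactLie)
    {U : Submodule ℂ V}
    (hU : U ≤ Submodule.span ℂ {u | u ∈ U ∧ ∃ c : ℂ,
      ρ𝔤 (LieSubalgebra.inclusion G.compactLie_le_lie X) u = c • u})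
    (t : ℝ) {u : V} (hu : u ∈ U) : ρK (G.expK (t • X)) u ∈ U := by
  have hu' := hU hu
  clear hu
  induction hu' using Submodule.span_induction with
  | mem x hx =>
    obtain ⟨hxU, c, hc⟩ := hx
    rw [h.apply_expK_smul_of_eigenvector X hc t]
    exact Submodule.smul_mem _ _ hxU
  | zero => rw [map_zero]; exact zero_mem _
  | add x y _ _ hx hy => rw [map_add]; exact add_mem hx hy
  | smul a x _ hx => rw [map_smul]; exact Submodule.smul_mem _ _ hx


/-- **A subspace stable under the one-parameter group `exp tX ⊆ K` is stable under `ρ𝔤 X`.**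
For `U ≤ V` with `ρK (exp tX) U ⊆ U` for all `t` and `u ∈ U`: every functional `ℓ` vanishing on
`U` has `ℓ (ρK (exp tX) u) = 0` identically, so its derivative `ℓ (ρ𝔤 X u)` at `t = 0`
(`hasWeakDeriv`) vanishes, and `U = U^{⊥⊥}`
(`Subspace.forall_mem_dualAnnihilator_apply_eq_zero_iff`). Wallach §3.3.1 (the `K`-finite
vectors form a `𝔨`-module). [folklore] -/
theorem apply_mem_of_expK_stable (h : IsGKModule G ρK ρ𝔤) (X : G.compactLie) {U : Submodule ℂ V}
    (hU : ∀ (t : ℝ), ∀ u ∈ U, ρK (G.expK (t • X)) u ∈ U) {u : V} (hu : u ∈ U) :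
    ρ𝔤 (LieSubalgebra.inclusion G.compactLie_le_lie X) u ∈ U := by
  refine (Subspace.forall_mem_dualAnnihilator_apply_eq_zero_iff U _).1 fun ℓ hℓ ↦ ?_
  have h1 := h.hasWeakDeriv X u ℓ
  have h2 : HasDerivAt (fun t : ℝ ↦ ℓ (ρK (G.expK (t • X)) u)) 0 0 := by
    refine (hasDerivAt_const (0 : ℝ) (0 : ℂ)).congr_of_eventuallyEq
      (Filter.Eventually.of_forall fun t ↦ ?_)
    exact (Submodule.mem_dualAnnihilator ℓ).1 hℓ _ (hU t u hu)
  exact h1.unique h2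

/-- **Eigenvectors of `ρ𝔤 X` (`X ∈ 𝔨`) exist in every non-zero finite-dimensional subspace stable
under `exp tX`** (`ρ𝔤 X` preserves it, `apply_mem_of_expK_stable`, and `ℂ` is algebraically
closed). [folklore] -/
theorem exists_eigenvector_of_expK_stable (h : IsGKModule G ρK ρ𝔤) (X : G.compactLie)
    {U : Submodule ℂ V} [FiniteDimensional ℂ U] (hU0 : U ≠ ⊥)
    (hU : ∀ (t : ℝ), ∀ u ∈ U, ρK (G.expK (t • X)) u ∈ U) :
    ∃ u ∈ U, u ≠ 0 ∧ ∃ c : ℂ, ρ𝔤 (LieSubalgebra.inclusion G.compactLie_le_lie X) u = c • u := by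
  -- restrict `ρ𝔤 X` to `U`
  set T : Module.End ℂ V := ρ𝔤 (LieSubalgebra.inclusion G.compactLie_le_lie X) with hT
  have hTU : ∀ u ∈ U, T u ∈ U := fun u hu ↦ h.apply_mem_of_expK_stable X hU hu
  let TU : Module.End ℂ U := T.restrict hTU
  haveI : Nontrivial U := Submodule.nontrivial_iff_ne_bot.2 hU0
  obtain ⟨c, hc⟩ := Module.End.exists_eigenvalue TU
  obtain ⟨w, hw⟩ := hc.exists_hasEigenvector
  refine ⟨(w : V), w.2, fun h0 ↦ hw.2 (Subtype.ext h0), c, ?_⟩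
  have := hw.apply_eq_smul
  have h1 : ((TU w : U) : V) = T w := rfl
  rw [← h1, this]
  rfl

/-- **Every non-zero `(𝔤, K)`-module has an eigenvector of `ρ𝔤 X` for each `X ∈ 𝔨`**: the span
of the `K`-orbit of a non-zero vector is finite-dimensional (`kFinite`), non-zero and `K`-stable.
Wallach §3.3.1. [folklore] -/
theorem exists_eigenvector (h : IsGKModule G ρK ρ𝔤) (X : G.compactLie) [Nontrivial V] :
    ∃ u : V, u ≠ 0 ∧ ∃ c : ℂ, ρ𝔤 (LieSubalgebra.inclusion G.compactLie_le_lie X) u = c • u := by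
  obtain ⟨v, hv⟩ := exists_ne (0 : V)
  let U : Submodule ℂ V := Submodule.span ℂ (Set.range fun k : G.maximalCompact ↦ ρK k v)
  haveI : FiniteDimensional ℂ U := h.kFinite v
  have hvU : v ∈ U := by
    have : ρK 1 v = v := by rw [map_one, Module.End.one_apply]
    exact Submodule.subset_span ⟨1, this⟩
  have hU0 : U ≠ ⊥ := fun h0 ↦ hv (by simpa [h0] using hvU)
  have hUK : ∀ (k : G.maximalCompact), ∀ u ∈ U, ρK k u ∈ U := by
    intro k u hu
    induction hu using Submodule.span_induction with
    | mem x hx =>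
      obtain ⟨k', rfl⟩ := hx
      rw [← Module.End.mul_apply, ← map_mul]
      exact Submodule.subset_span ⟨k * k', rfl⟩
    | zero => rw [map_zero]; exact zero_mem _
    | add x y _ _ hx hy => rw [map_add]; exact add_mem hx hy
    | smul a x _ hx => rw [map_smul]; exact Submodule.smul_mem _ _ hx
  obtain ⟨u, -, hu0, c, hc⟩ :=
    h.exists_eigenvector_of_expK_stable X hU0 fun t u hu ↦ hUK _ u hu
  exact ⟨u, hu0, c, hc⟩

end IsGKModule

end Literature.NumberTheory.Automorphic

end
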